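import Literature.AlgebraicTopology.SingularHomology.RelativeHurewiczEquivProofs
import Literature.AlgebraicTopology.SingularHomology.CollapseSimplexBridge
import Literature.AlgebraicTopology.SingularHomology.EilenbergRetractionProofs
import Literature.AlgebraicTopology.SingularHomology.RelativeEilenbergSubcomplexProofs
import HarnessLib

/-!
# The homotopy addition theorem for relative classes in degree `2` (discharge of `relHomotopyAddition_two`)

Topic `Literature/AlgebraicTopology/SingularHomology`, sibling proof file of
`RelativeHurewiczEquivProofs.lean`, whose named fact `relHomotopyAddition_two` — E. H. Spanier,
*Algebraic Topology* (1966; Springer 1981), Ch. 7 §5, **Prop. 3 (`B₂`)** p. 395 with the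
computation of part (d) p. 397 (`∑ (-1)ⁱ [σ⁽ⁱ⁾]' = η σ_# j_# (b₂) = 0`), in the form consumed for
`A` simply connected: for `τ : Δ³ → X` sending the `1`-skeleton into `A` and the vertices to `a`,
`[τ ∘ δ₀] · [τ ∘ δ₂] = [τ ∘ δ₁] · [τ ∘ δ₃]` in `π₂(X, A, a)` for the classes `relSimplexClass` of
`RelativeSimplexClass.lean` — is PROVED here (`relHomotopyAddition_two_holds`).

Spanier proves `B₂` in the universal example by a non-abelian computation in `π₁` of the
`1`-skeleton of `Δ³` (part (c), p. 396), the face `δ₀` being based at `v₁` and transported along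
`[v₀v₁]`. The proof given here trades that bookkeeping for the hypothesis `π₁(A) = 0` under which
the fact is stated, in three steps:

1. **Straightening the `1`-skeleton** (`RelHomotopyAdditionTwo.exists_straighten`): since `A` is
   simply connected, each of the six edges `τ ∘ δᵢ ∘ δⱼ`, a loop at `a` in `A`, is null-homotopic in
   `A` rel end points (`exists_nullHomotopy_of_goodEdge`); these homotopies, chosen once per edge,
   are compatible along the vertices and extend over the four faces and then over `Δ³` by the
   homotopy extension property of `(Δ^q, ∂Δ^q)` (`SimplexPrism.exists_fill`,
   `Homotopy/SimplexPrismExtension.lean`, glued by `EilenbergRetraction.compatible_faces_succ` —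
   the pattern of Spanier's own tower, Thm. 7.4.8, `EilenbergRetractionProofs.lean`). The end
   `τ'` of the deformation is constant `= a` on the `1`-skeleton, and along the deformation every
   face stays a map of triples `(Δ², ∂Δ², v₀) → (X, A, a)`, so that `[τ ∘ δᵢ] = [τ' ∘ δᵢ]`
   (`relSimplexClass_eq_of_homotopyWith`).
2. **Absolute classes**: each face `τ' ∘ δᵢ : (Δ², ∂Δ²) → (X, a)` has an absolute class, and
   `[τ' ∘ δᵢ] = j_* ⟦τ' ∘ δᵢ⟧` (`ofAbsolute_simplexClass`) with `j_*` multiplicative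
   (`RelHomotopyGroup.ofAbsolute_mul`, `RelativeHomotopyGroupStructure.lean`).
3. **The homotopy addition theorem in `π₂(X, a)`**: the tree's homotopy addition theorem
   `prod_collapseClass_face_zpow_eq_one` (`HomotopyAdditionProofs.lean`, from the cubical theorem of
   `Homotopy/CubicalHomotopyAddition.lean`) gives `c₀ c₁⁻¹ c₂ c₃⁻¹ = 1` for the classes
   `cᵢ = [τ' ∘ δᵢ ∘ κ_c]` read through the collapse `κ_c : I² → Δ²`; by
   `collapseClass_eq_simplexClass_two` (`CollapseSimplexBridge.lean`) these are the classes
   `⟦τ' ∘ δᵢ⟧ = [τ' ∘ δᵢ ∘ κ_h]` of `HurewiczSimplexClass.lean` behind `relSimplexClass`, and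
   `π₂(X, a)` being abelian, `⟦τ'δ₀⟧ ⟦τ'δ₂⟧ = ⟦τ'δ₁⟧ ⟦τ'δ₃⟧`.

With `isIso_toRelativeHomology_holds` (`RelativeEilenbergSubcomplexProofs.lean`) this leaves the
relative Hurewicz isomorphism `relativeHurewicz_equiv` (`relativeHurewicz_equiv_of_facts`) resting
on the single named fact `relHomotopyAddition` (`n ≥ 3`): `relativeHurewicz_equiv_of_homotopyAddition`.

## References

* E. H. Spanier, *Algebraic Topology*, Springer (1981), Ch. 7 §5, Prop. 3 (`B₂`) pp. 395–396 and
  part (d) of the proof of Thm. 7.5.4, p. 397; §4 Thm. 8 p. 393 (the tower). [Spanier1981]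
* A. Hatcher, *Algebraic Topology*, CUP (2002), Prop. 0.16 and §4.1 Lemma 4.7 (homotopy
  extension over simplices), §4.2 Thm. 4.32. [HatcherAT2002]
* H. Miller, *Lectures on Algebraic Topology*, World Scientific (2020/2022), Lecture 65,
  Thm. 65.4. [Miller2020]
-/

noncomputable section

open Set Function
open scoped unitInterval Topology Topology.Homotopy

universe u

namespace Literature.AlgebraicTopology.SingularHomology

open SingularSimplex
open Literature.AlgebraicTopology.Homotopy (RelHomotopyGroup RelGenLoop SimplexPrism.Compatible
  SimplexPrism.exists_fill)

namespace RelHomotopyAdditionTwo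

variable {X : Type u} [TopologicalSpace X] {A : Set X} {a : A}

/-! ### Small simplices: the boundary of `Δ¹`, the `1`-skeleton of `Δ³` -/

/-- A boundary point of `Δ¹` is one of its two vertices. [folklore] -/
lemma eq_vertex_of_mem_stdBoundary_one {v : StdSimplex 1} (hv : v ∈ stdBoundary 1) :
    v = stdSimplex.vertex (S := ℝ) 0 ∨ v = stdSimplex.vertex (S := ℝ) 1 := by
  obtain ⟨i, hi⟩ := hv
  have hi' : v i = 0 := hi
  have hsum : v 0 + v 1 = 1 := stdSimplex.add_eq_one v
  have h0 : ∀ w : StdSimplex 1, w 0 = 1 → w 1 = 0 → w = stdSimplex.vertex (S := ℝ) 0 := fun w hw0 hw1 => by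
    refine stdSimplex.ext (funext fun k => ?_)
    rw [stdSimplex.vertex_coe]
    rcases Fin.eq_zero_or_eq_succ k with rfl | ⟨k', rfl⟩
    · rw [hw0, Pi.single_eq_same]
    · rw [Subsingleton.elim k' 0, Pi.single_eq_of_ne (by decide)]
      exact hw1
  have h1 : ∀ w : StdSimplex 1, w 0 = 0 → w 1 = 1 → w = stdSimplex.vertex (S := ℝ) 1 := fun w hw0 hw1 => by
    refine stdSimplex.ext (funext fun k => ?_)
    rw [stdSimplex.vertex_coe]
    rcases Fin.eq_zero_or_eq_succ k with rfl | ⟨k', rfl⟩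
    · rw [hw0, Pi.single_eq_of_ne (by decide)]
    · rw [Subsingleton.elim k' 0]
      change w 1 = (Pi.single (1 : Fin 2) (1 : ℝ) : Fin 2 → ℝ) 1
      rw [hw1, Pi.single_eq_same]
  rcases Fin.eq_zero_or_eq_succ i with rfl | ⟨i', rfl⟩
  · exact Or.inr (h1 v hi' (by linarith))
  · rw [Subsingleton.elim i' 0] at hi'
    exact Or.inl (h0 v (by change v 1 = 0 at hi'; linarith) hi')

/-- The boundary of `Δ¹` is mapped by `stdSimplexHomeomorphUnitInterval` to `{0, 1}`. [folklore] -/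
lemma homeo_mem_of_mem_stdBoundary_one {v : StdSimplex 1} (hv : v ∈ stdBoundary 1) :
    stdSimplexHomeomorphUnitInterval v ∈ ({0, 1} : Set I) := by
  rcases eq_vertex_of_mem_stdBoundary_one hv with rfl | rfl
  · exact Or.inl stdSimplexHomeomorphUnitInterval_zero
  · exact Or.inr stdSimplexHomeomorphUnitInterval_one

/-- A point of the `1`-skeleton of `Δ³` lies on an edge `δᵢ δⱼ (Δ¹)`. [folklore] -/
lemma exists_eq_stdFace_stdFace {t : StdSimplex 3} (ht : t ∈ stdSkel 3 1) :
    ∃ (i : Fin 4) (j : Fin 3) (u : StdSimplex 1), t = stdFace i (stdFace j u) := by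
  have hb : t ∈ stdBoundary 3 := by
    rw [stdBoundary_eq_stdSkel]; exact stdSkel_mono 3 (by norm_num) ht
  obtain ⟨i, hi⟩ := (mem_stdBoundary_iff t).1 hb
  obtain ⟨t', rfl⟩ := exists_stdFace_eq i t hi
  have hb' : t' ∈ stdBoundary 2 := by
    rw [stdBoundary_eq_stdSkel]; exact (stdFace_mem_stdSkel_iff i t').1 ht
  obtain ⟨j, hj⟩ := (mem_stdBoundary_iff t').1 hb'
  obtain ⟨u, rfl⟩ := exists_stdFace_eq j t' hj
  exact ⟨i, j, u, rfl⟩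

/-- The edges `δᵢ δⱼ (Δ¹)` lie in the `1`-skeleton of `Δ³`. [folklore] -/
lemma stdFace_stdFace_mem_stdSkel (i : Fin 4) (j : Fin 3) (u : StdSimplex 1) :
    stdFace i (stdFace j u) ∈ stdSkel 3 1 :=
  stdFace_mem_stdSkel i (stdFace_mem_stdSkel j (by rw [stdSkel_eq_univ le_rfl]; trivial))

/-- A boundary point of `Δ²` which is a vertex comes from a boundary point of `Δ¹`: if
`δⱼ u ∈ (Δ²)⁰` then `u ∈ ∂Δ¹`. [folklore] -/
lemma mem_stdBoundary_one_of_stdFace_mem_stdSkel_zero {j : Fin 3} {u : StdSimplex 1}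
    (h : stdFace j u ∈ stdSkel 2 0) : u ∈ stdBoundary 1 := by
  rw [stdBoundary_eq_stdSkel]; exact (stdFace_mem_stdSkel_iff j u).1 h

/-- The vertex `v₀` of `Δ²` lies in the `0`-skeleton. [folklore] -/
lemma vertex_zero_mem_stdSkel : (stdSimplex.vertex (S := ℝ) (0 : Fin 3) : StdSimplex 2) ∈ stdSkel 2 0 :=
  vertex_mem_stdSkel_zero 0

/-! ### Good edges and their null-homotopies inside `A` -/

variable (A a) in
/-- A **good edge**: a `1`-simplex of `X` lying in `A` with both end points at `a` — the edges
`τ ∘ δᵢ ∘ δⱼ` of a simplex as in `relHomotopyAddition_two`. [folklore] -/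
def GoodEdge (e : C(StdSimplex 1, X)) : Prop := (∀ t, e t ∈ A) ∧ ∀ v ∈ stdBoundary 1, e v = a

/-- **A good edge is null-homotopic inside `A` rel end points** (`A` simply connected): a homotopy
`H : Δ¹ × I → X` from `e` to the constant `a`, inside `A`, fixing the two vertices. [folklore] -/
theorem exists_nullHomotopy_of_goodEdge [SimplyConnectedSpace A] {e : C(StdSimplex 1, X)}
    (he : GoodEdge A a e) :
    ∃ H : C(StdSimplex 1 × I, X), (∀ t, H (t, 0) = e t) ∧ (∀ t, H (t, 1) = a) ∧
      (∀ v ∈ stdBoundary 1, ∀ s, H (v, s) = a) ∧ ∀ p, H p ∈ A := by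
  -- the edge as a loop at `a` in the subspace `A`, parametrised by `[0, 1]`
  let e' : C(StdSimplex 1, A) := ⟨fun t => ⟨e t, he.1 t⟩, (e.continuous.subtype_mk _)⟩
  have h0 : stdSimplexHomeomorphUnitInterval.symm 0 = stdSimplex.vertex (S := ℝ) (0 : Fin 2) := by
    rw [Homeomorph.symm_apply_eq]; exact stdSimplexHomeomorphUnitInterval_zero.symm
  have h1 : stdSimplexHomeomorphUnitInterval.symm 1 = stdSimplex.vertex (S := ℝ) (1 : Fin 2) := by
    rw [Homeomorph.symm_apply_eq]; exact stdSimplexHomeomorphUnitInterval_one.symm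
  have hv0 : (stdSimplex.vertex (S := ℝ) (0 : Fin 2) : StdSimplex 1) ∈ stdBoundary 1 := ⟨1, by simp [stdSimplex.vertex]⟩
  have hv1 : (stdSimplex.vertex (S := ℝ) (1 : Fin 2) : StdSimplex 1) ∈ stdBoundary 1 := ⟨0, by simp [stdSimplex.vertex]⟩
  let γ : Path a a :=
    { toFun := fun u => e' (stdSimplexHomeomorphUnitInterval.symm u)
      continuous_toFun := e'.continuous.comp stdSimplexHomeomorphUnitInterval.symm.continuous
      source' := by
        apply Subtype.ext
        change e (stdSimplexHomeomorphUnitInterval.symm 0) = a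
        rw [h0]; exact he.2 _ hv0
      target' := by
        apply Subtype.ext
        change e (stdSimplexHomeomorphUnitInterval.symm 1) = a
        rw [h1]; exact he.2 _ hv1 }
  obtain ⟨F⟩ := SimplyConnectedSpace.paths_homotopic γ (Path.refl a)
  refine ⟨⟨fun p => (F (p.2, stdSimplexHomeomorphUnitInterval p.1) : X),
    continuous_subtype_val.comp (F.continuous.comp (continuous_snd.prodMk
      (stdSimplexHomeomorphUnitInterval.continuous.comp continuous_fst)))⟩, ?_, ?_, ?_, ?_⟩
  · intro t
    change ((F (0, stdSimplexHomeomorphUnitInterval t) : A) : X) = e t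
    rw [F.apply_zero]
    change ((e' (stdSimplexHomeomorphUnitInterval.symm (stdSimplexHomeomorphUnitInterval t)) : A) : X) = e t
    rw [Homeomorph.symm_apply_apply]
    rfl
  · intro t
    change ((F (1, stdSimplexHomeomorphUnitInterval t) : A) : X) = a
    rw [F.apply_one]
    rfl
  · intro v hv s
    change ((F (s, stdSimplexHomeomorphUnitInterval v) : A) : X) = a
    rcases homeo_mem_of_mem_stdBoundary_one hv with h | h
    · rw [show stdSimplexHomeomorphUnitInterval v = 0 from h, F.source]
    · rw [show stdSimplexHomeomorphUnitInterval v = 1 from h, F.target]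
  · intro p
    exact (F _).2

/-! ### The deformation of the `1`-skeleton, extended over faces and solid simplex -/

section Tower

variable [SimplyConnectedSpace A]

variable (A a) in
open Classical in
/-- **Level `1`**: to every `1`-simplex the null-homotopy of `exists_nullHomotopy_of_goodEdge` if it
is a good edge, the constant homotopy otherwise. [folklore] -/
def P₁ (e : SingularSimplex X 1) : C(StdSimplex 1 × I, X) :=
  if h : GoodEdge A a (toContinuousMap e) then Classical.choose (exists_nullHomotopy_of_goodEdge h)
  else (toContinuousMap e).comp ContinuousMap.fst

/-- `P₁` starts at the edge. [folklore] -/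
lemma P₁_zero (e : SingularSimplex X 1) (t : StdSimplex 1) : P₁ A a e (t, 0) = toContinuousMap e t := by
  unfold P₁
  split_ifs with h
  · exact (Classical.choose_spec (exists_nullHomotopy_of_goodEdge h)).1 t
  · rfl

/-- `P₁` fixes the end points. [folklore] -/
lemma P₁_of_mem_stdBoundary (e : SingularSimplex X 1) {v : StdSimplex 1} (hv : v ∈ stdBoundary 1) (s : I) :
    P₁ A a e (v, s) = toContinuousMap e v := by
  unfold P₁
  split_ifs with h
  · rw [(Classical.choose_spec (exists_nullHomotopy_of_goodEdge h)).2.2.1 v hv s, h.2 v hv]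
  · rfl

/-- On a good edge `P₁` stays in `A`. [folklore] -/
lemma P₁_mem {e : SingularSimplex X 1} (h : GoodEdge A a (toContinuousMap e)) (p : StdSimplex 1 × I) :
    P₁ A a e p ∈ A := by
  unfold P₁
  rw [dif_pos h]
  exact (Classical.choose_spec (exists_nullHomotopy_of_goodEdge h)).2.2.2 p

/-- On a good edge `P₁` ends at the constant `a`. [folklore] -/
lemma P₁_one {e : SingularSimplex X 1} (h : GoodEdge A a (toContinuousMap e)) (t : StdSimplex 1) :
    P₁ A a e (t, 1) = a := by
  unfold P₁
  rw [dif_pos h]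
  exact (Classical.choose_spec (exists_nullHomotopy_of_goodEdge h)).2.1 t

/-- The level-`1` data over a `2`-simplex are compatible (they fix the vertices). [folklore] -/
lemma compatible_P₁ (ρ : SingularSimplex X 2) : SimplexPrism.Compatible (fun j => P₁ A a (ρ.face j)) := by
  refine EilenbergRetraction.compatible_faces_succ (P₁ A a)
    (fun v : SingularSimplex X 0 => (toContinuousMap v).comp ContinuousMap.fst) (fun e i t s => ?_) ρ
  change P₁ A a e (stdFace i t, s) = toContinuousMap (e.face i) t
  rw [P₁_of_mem_stdBoundary e (stdFace_mem_stdBoundary i t), toContinuousMap_face_apply]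

/-- **Level `2`**: over every `2`-simplex, a filling of the prism with bottom the simplex and sides
the level-`1` homotopies of its edges (`SimplexPrism.exists_fill`). [folklore] -/
lemma exists_P₂ (ρ : SingularSimplex X 2) :
    ∃ G : C(StdSimplex 2 × I, X), (∀ t, G (t, 0) = toContinuousMap ρ t) ∧
      ∀ j t s, G (stdFace j t, s) = P₁ A a (ρ.face j) (t, s) :=
  SimplexPrism.exists_fill (toContinuousMap ρ) (fun j => P₁ A a (ρ.face j)) (compatible_P₁ ρ)
    (fun j t => by
      change P₁ A a (ρ.face j) (t, 0) = toContinuousMap ρ (stdFace j t)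
      rw [P₁_zero, toContinuousMap_face_apply])

variable (A a) in
/-- The chosen level-`2` filling. [folklore] -/
def P₂ (ρ : SingularSimplex X 2) : C(StdSimplex 2 × I, X) := Classical.choose (exists_P₂ (A := A) (a := a) ρ)

/-- `P₂` starts at the simplex. [folklore] -/
lemma P₂_zero (ρ : SingularSimplex X 2) (t : StdSimplex 2) : P₂ A a ρ (t, 0) = toContinuousMap ρ t :=
  (Classical.choose_spec (exists_P₂ (A := A) (a := a) ρ)).1 t

/-- `P₂` restricts on the edges to `P₁` (Spanier's (c)). [folklore] -/
lemma P₂_stdFace (ρ : SingularSimplex X 2) (j : Fin 3) (t : StdSimplex 1) (s : I) :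
    P₂ A a ρ (stdFace j t, s) = P₁ A a (ρ.face j) (t, s) :=
  (Classical.choose_spec (exists_P₂ (A := A) (a := a) ρ)).2 j t s

/-- `P₂` fixes the vertices. [folklore] -/
lemma P₂_of_mem_stdSkel_zero (ρ : SingularSimplex X 2) {t : StdSimplex 2} (ht : t ∈ stdSkel 2 0) (s : I) :
    P₂ A a ρ (t, s) = toContinuousMap ρ t := by
  have hb : t ∈ stdBoundary 2 := by rw [stdBoundary_eq_stdSkel]; exact stdSkel_mono 2 (by norm_num) ht
  obtain ⟨j, hj⟩ := (mem_stdBoundary_iff t).1 hb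
  obtain ⟨u, rfl⟩ := exists_stdFace_eq j t hj
  rw [P₂_stdFace, P₁_of_mem_stdBoundary _ (mem_stdBoundary_one_of_stdFace_mem_stdSkel_zero ht),
    toContinuousMap_face_apply]

/-- If all edges of `ρ` are good, `P₂ ρ` keeps `∂Δ²` inside `A`. [folklore] -/
lemma P₂_mem_of_mem_stdBoundary (ρ : SingularSimplex X 2) (hρ : ∀ j, GoodEdge A a (toContinuousMap (ρ.face j)))
    {t : StdSimplex 2} (ht : t ∈ stdBoundary 2) (s : I) : P₂ A a ρ (t, s) ∈ A := by
  obtain ⟨j, hj⟩ := (mem_stdBoundary_iff t).1 ht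
  obtain ⟨u, rfl⟩ := exists_stdFace_eq j t hj
  rw [P₂_stdFace]
  exact P₁_mem (hρ j) _

/-- If all edges of `ρ` are good, `P₂ ρ` ends constant `= a` on `∂Δ²`. [folklore] -/
lemma P₂_one_of_mem_stdBoundary (ρ : SingularSimplex X 2) (hρ : ∀ j, GoodEdge A a (toContinuousMap (ρ.face j)))
    {t : StdSimplex 2} (ht : t ∈ stdBoundary 2) : P₂ A a ρ (t, 1) = a := by
  obtain ⟨j, hj⟩ := (mem_stdBoundary_iff t).1 ht
  obtain ⟨u, rfl⟩ := exists_stdFace_eq j t hj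
  rw [P₂_stdFace]
  exact P₁_one (hρ j) _

/-- The level-`2` data over a `3`-simplex are compatible (they restrict to `P₁` on the edges).
[folklore] -/
lemma compatible_P₂ (σ₃ : SingularSimplex X 3) : SimplexPrism.Compatible (fun i => P₂ A a (σ₃.face i)) :=
  EilenbergRetraction.compatible_faces_succ (P₂ A a) (P₁ A a) (fun ρ j t s => P₂_stdFace ρ j t s) σ₃

end Tower

/-! ### Straightening the `1`-skeleton of `τ` -/

/-- The edges of a simplex as in `relHomotopyAddition_two` are good. [folklore] -/
lemma goodEdge_face_face (τ : C(StdSimplex 3, X)) (hA : ∀ t ∈ stdSkel 3 1, τ t ∈ A)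
    (hv : ∀ i : Fin 4, τ (stdSimplex.vertex (S := ℝ) i) = a) (i : Fin 4) (j : Fin 3) :
    GoodEdge A a (toContinuousMap (((ofMap τ).face i).face j)) := by
  rw [ofMap_face, ofMap_face, toContinuousMap_ofMap]
  refine ⟨fun u => hA _ (stdFace_stdFace_mem_stdSkel i j u), fun v hv' => ?_⟩
  change τ (stdFace i (stdFace j v)) = a
  rcases eq_vertex_of_mem_stdBoundary_one hv' with rfl | rfl <;>
    rw [stdFace_apply j, stdSimplex.map_vertex, stdFace_apply i, stdSimplex.map_vertex, hv]

/-- **Straightening the `1`-skeleton.** For `A` simply connected and `τ : Δ³ → X` with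
`τ((Δ³)¹) ⊆ A`, `τ(vertices) = a`, there is a deformation `G : Δ³ × I → X` of `τ` whose end `τ'`
is constant `= a` on the `1`-skeleton, and which on every face `δᵢ` keeps `∂Δ²` in `A` and the
vertices at `a` (so that the faces move through maps of triples `(Δ², ∂Δ², v₀) → (X, A, a)`) and
ends, on `∂Δ²`, at the constant `a`. [folklore] -/
theorem exists_straighten [SimplyConnectedSpace A] (τ : C(StdSimplex 3, X))
    (hA : ∀ t ∈ stdSkel 3 1, τ t ∈ A) (hv : ∀ i : Fin 4, τ (stdSimplex.vertex (S := ℝ) i) = a) :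
    ∃ G : C(StdSimplex 3 × I, X), (∀ t, G (t, 0) = τ t) ∧
      (∀ t ∈ stdSkel 3 1, G (t, 1) = a) ∧
      (∀ (i : Fin 4), ∀ t ∈ stdBoundary 2, ∀ s, G (stdFace i t, s) ∈ A) ∧
      (∀ (i : Fin 4), ∀ t ∈ stdSkel 2 0, ∀ s, G (stdFace i t, s) = τ (stdFace i t)) ∧
      (∀ (i : Fin 4), ∀ t ∈ stdBoundary 2, G (stdFace i t, 1) = a) := by
  set σ₃ : SingularSimplex X 3 := ofMap τ with hσ₃
  have hgood : ∀ (i : Fin 4) (j : Fin 3), GoodEdge A a (toContinuousMap ((σ₃.face i).face j)) :=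
    goodEdge_face_face τ hA hv
  obtain ⟨G, hG0, hGF⟩ := SimplexPrism.exists_fill τ (fun i => P₂ A a (σ₃.face i)) (compatible_P₂ σ₃)
    (fun i t => by
      change P₂ A a (σ₃.face i) (t, 0) = τ (stdFace i t)
      rw [P₂_zero, toContinuousMap_face_apply, hσ₃, toContinuousMap_ofMap])
  have hface : ∀ (i : Fin 4) (t : StdSimplex 2), toContinuousMap (σ₃.face i) t = τ (stdFace i t) := fun i t => by
    rw [toContinuousMap_face_apply, hσ₃, toContinuousMap_ofMap]
  have hGF' : ∀ (i : Fin 4) (t : StdSimplex 2) (s : I), G (stdFace i t, s) = P₂ A a (σ₃.face i) (t, s) := hGF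
  refine ⟨G, hG0, fun t ht => ?_, fun i t ht s => ?_, fun i t ht s => ?_, fun i t ht => ?_⟩
  · obtain ⟨i, j, u, rfl⟩ := exists_eq_stdFace_stdFace ht
    rw [hGF', P₂_stdFace]
    exact P₁_one (hgood i j) u
  · rw [hGF']; exact P₂_mem_of_mem_stdBoundary _ (hgood i) ht s
  · rw [hGF', P₂_of_mem_stdSkel_zero _ ht, hface]
  · rw [hGF']; exact P₂_one_of_mem_stdBoundary _ (hgood i) ht

/-! ### The degree-`2` identity -/

/-- The algebra of the alternating product over `Fin 4` in an abelian group: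
`c₀ c₁⁻¹ c₂ c₃⁻¹ = 1 ⟹ c₀ c₂ = c₁ c₃`. [folklore] -/
lemma mul_eq_mul_of_prod_zpow_eq_one {G : Type*} [CommGroup G] (c : Fin 4 → G)
    (h : ∏ i : Fin 4, c i ^ ((-1 : ℤ) ^ (i : ℕ)) = 1) : c 0 * c 2 = c 1 * c 3 := by
  rw [Fin.prod_univ_four] at h
  simp only [Fin.val_zero, Fin.val_one, Fin.val_two, show ((3 : Fin 4) : ℕ) = 3 from rfl, pow_zero,
    pow_one, zpow_one, zpow_neg, show ((-1 : ℤ) ^ 2) = 1 by norm_num,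
    show ((-1 : ℤ) ^ 3) = -1 by norm_num] at h
  -- `h : c 0 * (c 1)⁻¹ * c 2 * (c 3)⁻¹ = 1`
  rw [mul_inv_eq_one] at h
  rw [← h, mul_right_comm, mul_comm (c 1), inv_mul_cancel_right]

/-- **The homotopy addition theorem in `π₂(X, a)` for the radial device**: for `τ' : Δ³ → X`
constant `= a` on the `1`-skeleton, `⟦τ'δ₀⟧ ⟦τ'δ₂⟧ = ⟦τ'δ₁⟧ ⟦τ'δ₃⟧` for the classes
`simplexClass` (through the collapse device and `collapseClass_eq_simplexClass_two`).
[cite: Spanier1981, Ch. 7 §5 Prop. 3] -/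
theorem simplexClass_face_two {x₀ : X} (τ' : C(StdSimplex 3, X)) (hτ' : ∀ t ∈ stdSkel 3 1, τ' t = x₀) :
    simplexClass (τ'.comp (stdFace 0)) (comp_stdFace_apply_of_mem_stdSkel τ' hτ' 0) *
        simplexClass (τ'.comp (stdFace 2)) (comp_stdFace_apply_of_mem_stdSkel τ' hτ' 2) =
      simplexClass (τ'.comp (stdFace 1)) (comp_stdFace_apply_of_mem_stdSkel τ' hτ' 1) *
        simplexClass (τ'.comp (stdFace 3)) (comp_stdFace_apply_of_mem_stdSkel τ' hτ' 3) := by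
  have h := prod_collapseClass_face_zpow_eq_one (k := 0) τ' hτ'
  have key := mul_eq_mul_of_prod_zpow_eq_one
    (fun i => collapseClass (τ'.comp (stdFace i)) (comp_stdFace_apply_of_mem_stdSkel τ' hτ' i)) h
  simpa only [collapseClass_eq_simplexClass_two] using key

/-- **`B₂` for the relative classes** — discharge of the named fact `relHomotopyAddition_two`
(Spanier 1981, Ch. 7 §5 Prop. 3 with (d) p. 397, degree `2`, `A` simply connected): for
`τ : Δ³ → X` with `τ((Δ³)¹) ⊆ A` and `τ(vertices) = a`,
`[τ ∘ δ₀] · [τ ∘ δ₂] = [τ ∘ δ₁] · [τ ∘ δ₃]` in `π₂(X, A, a)`. [cite: Spanier1981, Ch. 7 §5 Prop. 3] -/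
theorem relHomotopyAddition_two_holds : relHomotopyAddition_two.{u} := by
  intro X _ A _ a τ hA hv
  obtain ⟨G, hG0, hG1, hGA, hGv, hGend⟩ := exists_straighten (A := A) (a := a) τ hA hv
  -- the straightened simplex
  let τ' : C(StdSimplex 3, X) := ⟨fun t => G (t, 1), G.continuous.comp (Continuous.prodMk_left (1 : I))⟩
  have hτ' : ∀ t ∈ stdSkel 3 1, τ' t = (a : X) := fun t ht => hG1 t ht
  have hτ'b : ∀ (i : Fin 4), ∀ t ∈ stdBoundary 2, (τ'.comp (stdFace i)) t = (a : X) := fun i t ht => hGend i t ht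
  -- the faces move through maps of triples: `[τ ∘ δᵢ] = [τ' ∘ δᵢ]`
  have hmove : ∀ i : Fin 4, relSimplexClass (m := 1) (a := a) (τ.comp (stdFace i))
      (comp_stdFace_mem_relSimplexMap (m := 1) τ hA hv i) =
      relSimplexClass (m := 1) (a := a) (τ'.comp (stdFace i)) (mem_relSimplexMap_of_boundary _ (hτ'b i)) := by
    intro i
    refine relSimplexClass_eq_of_homotopyWith _ _
      { toFun := fun p => G (stdFace i p.2, p.1)
        continuous_toFun := G.continuous.comp ((stdFace i).continuous.comp continuous_snd |>.prodMk continuous_fst)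
        map_zero_left := fun t => hG0 (stdFace i t)
        map_one_left := fun t => rfl
        prop' := fun s => ⟨fun t ht => hGA i t ht s, ?_⟩ }
    change G (stdFace i (stdSimplex.vertex 0), s) = a
    rw [hGv i _ vertex_zero_mem_stdSkel s, stdFace_vertex, hv]
  -- the absolute identity in `π₂(X, a)`, pushed along `j_*`
  have habs := congrArg (RelHomotopyGroup.ofAbsolute (A := A) (a := a) (0 : Fin 2)) (simplexClass_face_two τ' hτ')
  rw [RelHomotopyGroup.ofAbsolute_mul, RelHomotopyGroup.ofAbsolute_mul, ofAbsolute_simplexClass,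
    ofAbsolute_simplexClass, ofAbsolute_simplexClass, ofAbsolute_simplexClass] at habs
  rw [hmove 0, hmove 1, hmove 2, hmove 3]
  exact habs

end RelHomotopyAdditionTwo

/-- **`relHomotopyAddition_two` holds** (re-export at the fact's level). [cite: Spanier1981, Ch. 7 §5 Prop. 3] -/
theorem relHomotopyAddition_two_holds : relHomotopyAddition_two.{u} :=
  RelHomotopyAdditionTwo.relHomotopyAddition_two_holds

/-- **The relative Hurewicz isomorphism from the single remaining fact `relHomotopyAddition`**
(`n ≥ 3`): with `isIso_toRelativeHomology_holds` (Spanier Cor. 7.4.9, `RelativeEilenbergSubcomplexProofs.lean`)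
and `relHomotopyAddition_two_holds` (this file), `relativeHurewicz_equiv_of_facts` needs only `Bₙ`
for `n ≥ 3`. [cite: Spanier1981, Ch. 7 §5 Thm. 4] -/
theorem relativeHurewicz_equiv_of_homotopyAddition (hB : relHomotopyAddition.{u}) : relativeHurewicz_equiv.{u} :=
  relativeHurewicz_equiv_of_facts (isIso_toRelativeHomology_holds ℤ ℤ) hB relHomotopyAddition_two_holds

end Literature.AlgebraicTopology.SingularHomology

end
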